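import Mathlib
import HarnessLib

/-!
# A `p`-adic irrationality criterion from small integer linear forms

Cell `pub-zeta5`, family seat fam-catalan. HONEST FRAMING: systematic search; no irrationality claim unless
certified. This file is GENERAL INFRASTRUCTURE (no statement about any specific constant): the `p`-adic analogue
of the classical "`0 < |q_n ξ − p_n| → 0` fast enough ⇒ `ξ ∉ ℚ`" principle, in the form used by the 2-adic line of
the Catalan box family (`families/catalan/TWOADIC.md` §2): if integers `a_n, b_n` give NONZERO forms
`a_n ξ + b_n ∈ ℚ_[p]` with `‖a_n ξ + b_n‖_p · (|a_n| + |b_n|) → 0`, then `ξ` is not (the image of) a rational number.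

Proof (product formula in its most elementary guise): if `ξ = r = u/v`, then `D_n := a_n u + b_n v` is a nonzero
integer with `(D_n : ℚ_[p]) = v · (a_n ξ + b_n)`, so `1/|D_n| ≤ ‖D_n‖_p ≤ ‖a_n ξ + b_n‖_p`, while
`|D_n| ≤ (|a_n| + |b_n|) · max(|u|, v)`; hence `‖a_n ξ + b_n‖_p (|a_n| + |b_n|) ≥ 1 / max(|u|, v)` for all `n`,
contradicting the hypothesis.

* `one_div_natAbs_le_norm` — `1/|D| ≤ ‖(D : ℚ_[p])‖` for a nonzero integer `D`;
* `not_ratCast_of_small_forms` — the criterion (eventually-nonzero forms, product tending to `0`).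
-/

open Filter Topology

namespace Summit.KontsevichZagierPeriods.Zeta5Search.PadicIrrationality

variable {p : ℕ} [hp : Fact p.Prime]

-- (filing-lane edit, announced: the general lemma `‖(q : ℚ_[p])‖ = p ^ (−v_p q)` staged here as
-- `norm_ratCast_eq_zpow` is ALREADY a tree declaration of the same shape,
-- `WeierstrassCurve.norm_ratCast_eq_zpow` in `Literature/NumberTheory/EllipticCurves/CanonicalPAdicHeightLeavesProofs.lean`
-- (the gate dedups by statement shape across the whole tree); its one-line proof is inlined below instead of
-- importing that module.)

omit hp in
/-- For a nonzero integer `D`: `p ^ v_p(D) ≤ |D|`. -/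
theorem pow_padicValInt_le_natAbs {D : ℤ} (hD : D ≠ 0) : p ^ padicValInt p D ≤ D.natAbs := by
  unfold padicValInt
  exact Nat.le_of_dvd (Int.natAbs_pos.mpr hD) pow_padicValNat_dvd

/-- The elementary half of the product formula: a nonzero integer `D` has `1/|D| ≤ ‖D‖_p`. -/
theorem one_div_natAbs_le_norm {D : ℤ} (hD : D ≠ 0) :
    1 / (D.natAbs : ℝ) ≤ ‖(D : ℚ_[p])‖ := by
  have hp1 : (1 : ℝ) ≤ p := by exact_mod_cast hp.out.one_lt.le
  have hp0 : (0 : ℝ) < p := by linarith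
  have hq : ((D : ℚ)) ≠ 0 := by exact_mod_cast hD
  have hnorm : ‖((D : ℚ) : ℚ_[p])‖ = (p : ℝ) ^ (-padicValRat p D) := by
    rw [Padic.eq_padicNorm, padicNorm.eq_zpow_of_nonzero hq]; push_cast; rfl
  rw [show (D : ℚ_[p]) = ((D : ℚ) : ℚ_[p]) by norm_cast, hnorm, padicValRat.of_int,
    zpow_neg, zpow_natCast, one_div]
  have hle : ((p : ℝ) ^ padicValInt p D) ≤ (D.natAbs : ℝ) := by
    exact_mod_cast pow_padicValInt_le_natAbs hD
  have hpos : (0 : ℝ) < (p : ℝ) ^ padicValInt p D := pow_pos hp0 _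
  exact inv_anti₀ hpos hle

/-- **`p`-adic irrationality criterion.** If integer sequences `a_n, b_n` give eventually NONZERO linear forms
`a_n ξ + b_n` in `ℚ_[p]` whose `p`-adic size times archimedean height tends to `0`, then `ξ` is not rational. -/
theorem not_ratCast_of_small_forms (ξ : ℚ_[p]) (a b : ℕ → ℤ)
    (hne : ∀ᶠ n in atTop, (a n : ℚ_[p]) * ξ + b n ≠ 0)
    (hsmall : Tendsto (fun n => ‖(a n : ℚ_[p]) * ξ + b n‖ * ((a n).natAbs + (b n).natAbs : ℝ)) atTop (𝓝 0)) :
    ∀ r : ℚ, ξ ≠ ((r : ℚ) : ℚ_[p]) := by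
  intro r hr
  -- write r = u / v
  set u : ℤ := r.num with hu
  set v : ℕ := r.den with hv
  have hv0 : (v : ℤ) ≠ 0 := by exact_mod_cast r.den_nz
  have hvξ : (v : ℚ_[p]) * ξ = (u : ℚ_[p]) := by
    have h1 : ((r.den : ℚ) * r : ℚ) = (r.num : ℚ) := Rat.den_mul_eq_num r
    rw [hr, hu, hv]
    exact_mod_cast h1
  -- height
  set H : ℕ := max u.natAbs v with hH
  have hH1 : 1 ≤ H := le_trans r.den_pos (le_max_right _ _)
  have hHpos : (0 : ℝ) < H := by exact_mod_cast hH1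
  -- the bound 1/H ≤ size × height, for every n with a nonzero form
  have key : ∀ n, (a n : ℚ_[p]) * ξ + b n ≠ 0 →
      1 / (H : ℝ) ≤ ‖(a n : ℚ_[p]) * ξ + b n‖ * ((a n).natAbs + (b n).natAbs : ℝ) := by
    intro n hn
    set D : ℤ := a n * u + b n * v with hD
    have hDcast : (D : ℚ_[p]) = (v : ℚ_[p]) * ((a n : ℚ_[p]) * ξ + b n) := by
      rw [hD]; push_cast; rw [mul_add, ← mul_assoc, mul_comm (v : ℚ_[p]) (a n : ℚ_[p]), mul_assoc, hvξ]; ring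
    have hD0 : D ≠ 0 := by
      intro h0
      have : (v : ℚ_[p]) * ((a n : ℚ_[p]) * ξ + b n) = 0 := by rw [← hDcast, h0]; simp
      rcases mul_eq_zero.mp this with h1 | h1
      · exact hv0 (by exact_mod_cast h1)
      · exact hn h1
    -- lower bound on ‖D‖
    have hlow : 1 / (D.natAbs : ℝ) ≤ ‖(D : ℚ_[p])‖ := one_div_natAbs_le_norm hD0
    -- upper bound on ‖D‖
    have hup : ‖(D : ℚ_[p])‖ ≤ ‖(a n : ℚ_[p]) * ξ + b n‖ := by
      rw [hDcast, norm_mul]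
      calc ‖(v : ℚ_[p])‖ * ‖(a n : ℚ_[p]) * ξ + b n‖ ≤ 1 * ‖(a n : ℚ_[p]) * ξ + b n‖ := by
            gcongr
            have := Padic.norm_int_le_one (p := p) (v : ℤ)
            simpa using this
        _ = _ := one_mul _
    -- archimedean bound on |D|
    have hDabs : (D.natAbs : ℝ) ≤ ((a n).natAbs + (b n).natAbs : ℝ) * H := by
      have h1 : D.natAbs ≤ (a n).natAbs * u.natAbs + (b n).natAbs * v := by
        rw [hD]
        calc (a n * u + b n * ↑v).natAbs ≤ (a n * u).natAbs + (b n * ↑v).natAbs := Int.natAbs_add_le _ _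
          _ = (a n).natAbs * u.natAbs + (b n).natAbs * v := by
              rw [Int.natAbs_mul, Int.natAbs_mul, Int.natAbs_natCast]
      have h2 : (a n).natAbs * u.natAbs + (b n).natAbs * v ≤ ((a n).natAbs + (b n).natAbs) * H := by
        have hu' : u.natAbs ≤ H := le_max_left _ _
        have hv' : v ≤ H := le_max_right _ _
        calc (a n).natAbs * u.natAbs + (b n).natAbs * v ≤ (a n).natAbs * H + (b n).natAbs * H :=
              Nat.add_le_add (Nat.mul_le_mul_left _ hu') (Nat.mul_le_mul_left _ hv')
          _ = ((a n).natAbs + (b n).natAbs) * H := by ring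
      exact_mod_cast h1.trans h2
    have hDpos : (0 : ℝ) < D.natAbs := by exact_mod_cast Int.natAbs_pos.mpr hD0
    have hABpos : (0 : ℝ) < ((a n).natAbs + (b n).natAbs : ℝ) := by
      by_contra hle
      rw [not_lt] at hle
      have : (D.natAbs : ℝ) ≤ 0 := by nlinarith
      linarith
    -- combine: 1/H ≤ (A+B)/|D| ≤ (A+B) ‖D‖ ≤ (A+B) ‖form‖
    calc 1 / (H : ℝ) ≤ ((a n).natAbs + (b n).natAbs : ℝ) / D.natAbs := by
          rw [div_le_div_iff₀ hHpos hDpos]; linarith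
      _ = ((a n).natAbs + (b n).natAbs : ℝ) * (1 / D.natAbs) := by ring
      _ ≤ ((a n).natAbs + (b n).natAbs : ℝ) * ‖(a n : ℚ_[p]) * ξ + b n‖ := by gcongr; exact hlow.trans hup
      _ = _ := mul_comm _ _
  -- contradiction with the limit
  have hev : ∀ᶠ n in atTop, ‖(a n : ℚ_[p]) * ξ + b n‖ * ((a n).natAbs + (b n).natAbs : ℝ) < 1 / (H : ℝ) :=
    (hsmall.eventually (gt_mem_nhds (by positivity : (0 : ℝ) < 1 / H)))
  obtain ⟨n, hn1, hn2⟩ := (hne.and hev).exists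
  exact absurd (key n hn1) (not_le.mpr hn2)

end Summit.KontsevichZagierPeriods.Zeta5Search.PadicIrrationality
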